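import Mathlib
import HarnessLib
import Literature.Combinatorics.SimpleGraph.WallTopologicalMinor
import Literature.Combinatorics.SimpleGraph.SubcubicMinors
import Summits.ValiantsHypothesis.ValiantsHypothesis.Theorems.MonotoneRestorationMonotoneRestorationQPLinearWidthTreewidthMinorMonotone
import Summits.ValiantsHypothesis.ValiantsHypothesis.Theorems.MonotoneRestorationMonotoneRestorationQPLinearWidthWallTreewidth

/-!
# Route MonotoneRestoration, crux `MonotoneRestorationQP` (stmt-15886), line `linear_width` —
# A TOPOLOGICAL MINOR IS A MINOR; tree-width does not drop along subdivisions

Helper file (`--supports stmt-ValiantsHypothesis-15886`), def-free.  Generic piece named in the g13 census next to (P2'):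
the tree has the two minor relations `IsTopologicalMinor` (`H ≼ₜ G`: `G` contains a subdivision of `H`, `WallTopologicalMinor.lean`)
and `IsMinor` (`H ≼ₘ G`, branch sets, `SubcubicMinors.lean`) and Diestel's converse for subcubic `H`
(`IsMinor.isTopologicalMinor_of_degree_le_three`), but not the elementary direction.  Here:

* `IsTopologicalMinor.isMinor` — **`H ≼ₜ G ⇒ H ≼ₘ G`**: orient every edge of `H` by a chosen representative (`Quot.out`), put
  the interior vertices of the chosen path of an edge into the branch set of its tail; branch sets are stars of path prefixes,
  and the last edge of each chosen path joins the two branch sets;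
* `treewidth_le_of_isTopologicalMinor` — with `treewidth_le_of_isMinor` (p841521): **`H ≼ₜ G ⇒ tw H ≤ tw G`**; in particular
  every graph containing a subdivision of the `r`-wall has tree-width `≥ ⌊(r-1)/2⌋` (`le_treewidth_of_wall_topologicalMinor`, with
  `le_treewidth_wall`, p841536) — the bound (P2) will need for the bases it normalises out of an induced subdivided wall.

Honest label: library-type facts (Diestel §1.7, §12.3); no stub closed; θ₁, the cruxes and VP ≠ VNP NOT moved.
[cite: Diestel2010, §1.7 (subdivisions and minors), §12.3; GalesiEtAl2023, §2]
-/

set_option linter.dupNamespace false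

noncomputable section

open scoped Classical
open scoped Literature.Combinatorics.SimpleGraph

namespace Summit.ValiantsHypothesis.ValiantsHypothesis.Theorems.CFIHomMonotone

open Literature.Combinatorics.SimpleGraph (treewidth IsMinor IsTopologicalMinor wall)

/-- **A topological minor is a minor** (`H ≼ₜ G ⇒ H ≼ₘ G`). [cite: Diestel2010, §1.7] -/
theorem IsTopologicalMinor.isMinor {α β : Type*} {H : SimpleGraph α} {G : SimpleGraph β} (h : H ≼ₜ G) : H ≼ₘ G := by
  classical
  obtain ⟨f, P, hf, hpath, hbranch, hdisj⟩ := h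
  -- orient every edge by a chosen representative and take its path
  let tl : Sym2 α → α := fun e => (Quot.out e).1
  let hd : Sym2 α → α := fun e => (Quot.out e).2
  have hmk : ∀ e : Sym2 α, s(tl e, hd e) = e := fun e => Quot.out_eq e
  have hadj : ∀ e ∈ H.edgeSet, H.Adj (tl e) (hd e) := fun e he => by
    rw [← hmk e, SimpleGraph.mem_edgeSet] at he; exact he
  -- the chosen path of an edge
  let Q : ∀ e : Sym2 α, e ∈ H.edgeSet → G.Walk (f (tl e)) (f (hd e)) := fun e he => P (tl e) (hd e) (hadj e he)
  -- the branch-set map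
  let φ : β → Option α := fun x =>
    if hx : ∃ u, f u = x then some (Classical.choose hx)
    else if hx' : ∃ e, ∃ he : e ∈ H.edgeSet, x ∈ (Q e he).support then some (tl (Classical.choose hx')) else none
  have hφf : ∀ u, φ (f u) = some u := by
    intro u
    have hx : ∃ u', f u' = f u := ⟨u, rfl⟩
    simp only [φ, dif_pos hx, Option.some.injEq]
    exact hf (Classical.choose_spec hx)
  -- interior vertices of the chosen path of `e` lie over `tl e`
  have hφint : ∀ (e : Sym2 α) (he : e ∈ H.edgeSet) (x : β), x ∈ (Q e he).support → (¬ ∃ u, f u = x) →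
      φ x = some (tl e) := by
    intro e he x hx hnot
    have hx' : ∃ e', ∃ he' : e' ∈ H.edgeSet, x ∈ (Q e' he').support := ⟨e, he, hx⟩
    simp only [φ, dif_neg hnot, dif_pos hx', Option.some.injEq]
    -- the chosen edge is `e`: otherwise `x` would be a branch vertex
    set e' := Classical.choose hx' with he'def
    obtain ⟨he', hxe'⟩ := Classical.choose_spec hx'
    by_contra hne
    have hne' : s(tl e', hd e') ≠ s(tl e, hd e) := by
      rw [hmk, hmk]; intro h; exact hne (by rw [h])
    obtain ⟨w, hw⟩ := hdisj _ _ _ _ (hadj e' he') (hadj e he) hne' x hxe' hx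
    exact hnot ⟨w, hw⟩
  -- a vertex with `φ x = some a` is `f a` or an interior vertex of a chosen path with tail `a`
  have hcases : ∀ x a, φ x = some a → x = f a ∨
      ∃ e, ∃ he : e ∈ H.edgeSet, x ∈ (Q e he).support ∧ (¬ ∃ u, f u = x) ∧ tl e = a := by
    intro x a hxa
    by_cases hx : ∃ u, f u = x
    · obtain ⟨u, rfl⟩ := hx
      rw [hφf] at hxa
      exact Or.inl (by rw [Option.some.inj hxa])
    · by_cases hx' : ∃ e, ∃ he : e ∈ H.edgeSet, x ∈ (Q e he).support
      · obtain ⟨he', hxe'⟩ := Classical.choose_spec hx'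
        have h1 := hφint _ he' x hxe' hx
        rw [hxa, Option.some.injEq] at h1
        exact Or.inr ⟨_, he', hxe', hx, h1.symm⟩
      · simp only [φ, dif_neg hx, dif_neg hx'] at hxa
        exact absurd hxa (by simp)
  -- from an interior vertex back to the tail, inside the branch set
  have hprefix : ∀ (e : Sym2 α) (he : e ∈ H.edgeSet) (x : β) (hx : x ∈ (Q e he).support), (¬ ∃ u, f u = x) →
      ∃ w : G.Walk x (f (tl e)), ∀ z ∈ w.support, φ z = some (tl e) := by
    intro e he x hx hnot
    refine ⟨((Q e he).takeUntil x hx).reverse, fun z hz => ?_⟩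
    rw [SimpleGraph.Walk.support_reverse, List.mem_reverse] at hz
    have hzQ : z ∈ (Q e he).support := SimpleGraph.Walk.support_takeUntil_subset_support _ hx hz
    by_cases hzf : ∃ u, f u = z
    · obtain ⟨w, rfl⟩ := hzf
      rcases hbranch _ _ (hadj e he) w hzQ with hw | hw
      · rw [hw]; exact hφf _
      · -- `f (hd e)` is the end of the path and cannot precede `x ≠ f (hd e)`
        exfalso
        have hend : f w ∈ ((Q e he).dropUntil x hx).support := by
          rw [hw]; exact SimpleGraph.Walk.end_mem_support _
        have := Literature.Combinatorics.SimpleGraph.IsPath.eq_of_mem_support_takeUntil_dropUntil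
          (hpath _ _ (hadj e he)) hx hz hend
        exact hnot ⟨w, this⟩
    · exact hφint e he z hzQ hzf
  -- every vertex of a branch set is joined to its branch vertex inside the branch set
  have hreach : ∀ x a, φ x = some a → ∃ w : G.Walk x (f a), ∀ z ∈ w.support, φ z = some a := by
    intro x a hxa
    rcases hcases x a hxa with rfl | ⟨e, he, hx, hnot, rfl⟩
    · exact ⟨SimpleGraph.Walk.nil, fun z hz => by
        rw [SimpleGraph.Walk.support_nil, List.mem_singleton] at hz
        rw [hz]; exact hφf _⟩
    · exact hprefix e he x hx hnot
  refine ⟨φ, fun u => ⟨f u, hφf u⟩, ?_, ?_⟩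
  · -- branch sets are connected
    intro x y hxy hx
    obtain ⟨a, hxa⟩ := Option.ne_none_iff_exists'.1 hx
    obtain ⟨wx, hwx⟩ := hreach x a hxa
    obtain ⟨wy, hwy⟩ := hreach y a (hxy ▸ hxa)
    refine ⟨wx.append wy.reverse, fun z hz => ?_⟩
    rw [SimpleGraph.Walk.mem_support_append_iff] at hz
    rw [hxa]
    rcases hz with hz | hz
    · exact hwx z hz
    · rw [SimpleGraph.Walk.support_reverse, List.mem_reverse] at hz
      exact hwy z hz
  · -- every edge of `H` is realised between the two branch sets
    intro u v huv
    have he : s(u, v) ∈ H.edgeSet := (SimpleGraph.mem_edgeSet H).2 huv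
    -- the last edge of the chosen path of `s(u, v)`: reverse it and take the first edge
    have hne : f (hd s(u, v)) ≠ f (tl s(u, v)) := fun h => (hadj _ he).ne (hf h).symm
    obtain ⟨z, hz, p', hp'⟩ := SimpleGraph.Walk.exists_eq_cons_of_ne hne (Q _ he).reverse
    have hzQ : z ∈ (Q _ he).support := by
      have : z ∈ (Q _ he).reverse.support := by rw [hp']; simp
      rwa [SimpleGraph.Walk.support_reverse, List.mem_reverse] at this
    -- `z` lies over the tail
    have hφz : φ z = some (tl s(u, v)) := by
      by_cases hzf : ∃ w, f w = z
      · obtain ⟨w, rfl⟩ := hzf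
        rcases hbranch _ _ (hadj _ he) w hzQ with hw | hw
        · rw [hw]; exact hφf _
        · exact absurd (congrArg f hw) (G.ne_of_adj hz).symm
      · exact hφint _ he z hzQ hzf
    have hφh : φ (f (hd s(u, v))) = some (hd s(u, v)) := hφf _
    -- the orientation of `s(u, v)` is `(u, v)` or `(v, u)`
    have hor : (tl s(u, v) = u ∧ hd s(u, v) = v) ∨ (tl s(u, v) = v ∧ hd s(u, v) = u) := by
      have := hmk s(u, v)
      rw [Sym2.eq_iff] at this
      exact this
    rcases hor with ⟨ht, hh⟩ | ⟨ht, hh⟩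
    · refine ⟨z, f (hd s(u, v)), ?_, ?_, hz.symm⟩
      · rw [hφz, ht]
      · rw [hφh, hh]
    · refine ⟨f (hd s(u, v)), z, ?_, ?_, hz⟩
      · rw [hφh, hh]
      · rw [hφz, ht]

/-- **`H ≼ₜ G ⇒ tw H ≤ tw G`** (subdivision does not decrease tree-width). [cite: Diestel2010, §12.3] -/
theorem treewidth_le_of_isTopologicalMinor {α β : Type*} [Fintype α] [Fintype β] {H : SimpleGraph α}
    {G : SimpleGraph β} (h : H ≼ₜ G) : treewidth H ≤ treewidth G :=
  treewidth_le_of_isMinor (IsTopologicalMinor.isMinor h)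

/-- **Graphs containing a subdivided wall are wide**: if the `r`-wall is a topological minor of `G` and `2b + 1 ≤ r` then
`b ≤ tw G` (`le_treewidth_wall`, p841536, through `treewidth_le_of_isTopologicalMinor`). [cite: GalesiEtAl2023, §2; Diestel2010, §12.3] -/
theorem le_treewidth_of_wall_topologicalMinor {β : Type*} [Fintype β] {G : SimpleGraph β} {r b : ℕ}
    (hb : 2 * b + 1 ≤ r) (h : wall r ≼ₜ G) : b ≤ treewidth G :=
  (le_treewidth_wall hb).trans (treewidth_le_of_isTopologicalMinor h)

end Summit.ValiantsHypothesis.ValiantsHypothesis.Theorems.CFIHomMonotone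

end
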